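import Mathlib
import HarnessLib
import Summits.NavierStokesRegularity.NavierStokesRegularity.Theorems.PoloidalWindowDoorPoloidalWindowRigidityTimeShearVariance
import Summits.NavierStokesRegularity.NavierStokesRegularity.Theorems.PoloidalWindowDoorPoloidalWindowRigiditySeparatedShearDecay

/-!
# Route `PoloidalWindowDoor`, crux `PoloidalWindowRigidity` (K2, stmt-NavierStokesRegularity-19708) — the stratum (TV)
# «time-dependent proportional shear», branch (B) `liminf_{τ→−∞} |μ(τ)| < ∞` (stub `stub_tvLiminf` of the line
# `lrc-jet`): the horizontal variance of `v₂` has no past, and the shifted residual `f₂ − κv₂` is height-only ⇒ constant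

Cell ns-regularity-ideate, seat ns-poloidal-K2-p2 gen 3 (stub-worker under the K2 lead ns-poloidal-K2-p1 g4; file landed
`--supports stmt-NavierStokesRegularity-19708` as a helper toward the registered stub `stub_tvLiminf`).
Continuation of ns-poloidal-K2-p3 g4's `…TimeShearVariance` (the M12 chain of this seat re-run on the stratum
`∂₂v_b(s,·) ≡ μ(s)∂_b v₂(s,·)`, `b = 0,1`, all slices, `μ < 0` differentiable, `κ = μ′/(1−μ)`:
`Ψ' ≤ (3M₀/L)Ψ + 2κΨ + πL·K(t)/R`); K2-p3's own sequel `…TimeShearDecay.variance_small_TV` (landed in parallel) needs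
`1 − μ ≤ B` for ALL `τ ≤ t₁`.  The K2 lead's split of `stub_tv` (STATUS 2026-08-27T09:30Z)
is by `liminf`, not `sup`: branch (B) «`μ ≥ −M` ALONG SOME SEQUENCE `τ_k → −∞`» (this file) is complementary to his
zoom-out branch (G) «`μ(τ) → −∞`».  The point: in the Grönwall step only the DATUM `(1−μ(τ_k))²Ψ(τ_k)` needs the
bound — the forcing `W_k²L³K/R` (`W_k = max_{[τ_k,t₁]}(1−μ)`, a compact maximum) is paid by choosing `R` AFTER `τ_k`.

* `psiW_le_TV_Icc` — Grönwall on `[t₀, t₁]` for `(1−μ)²Ψ` with the integrating factor (`((1−μ)²)′ = −2κ(1−μ)²`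
  kills the source `2κΨ` exactly): `(1−μ(t₁))²Ψ(t₁) ≤ e^{A(t₁)}((1−μ(t₀))²Ψ(t₀) + W²·πL K(t₁)(t₁−t₀)/R)` whenever
  `1 − μ ≤ W` on `[t₀,t₁]` (the `Icc`-phrased twin of K2-p3's `…TimeShearDecay.psi_le_TV`, written in parallel);
* `variance_small_liminf` — for every `t₁ < 0`, `[a,b]`, `ε > 0`: `∫_{[a,b]} V_R(t₁,z) dz ≤ ε` for all large `R`
  (Grönwall from `t₀ = τ_k` with `L = √(−τ_k)`).
The sequels `…TimeShearLiminfSource` (tested momentum equation ⇒ `f₂ − κv₂` spatially constant) and `…TimeShearLiminf`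
(sequential decaying-slope Liouville lemma on `ψ = (1−μ)v₂`) close `stub_tvLiminf`.

WHAT THIS IS NOT: not a claim about Navier–Stokes regularity, not (TV) and not LRC″ — bricks of branch (B) of one located
stratum (bears_on LADDER-NS N0, rung N0-LocalTubeDoorPoloidal, crux K2 = stmt-19708).
-/

noncomputable section

-- the summit and its single sub-problem share the name (CONVENTIONS §1), as in every Theorems file
set_option linter.dupNamespace false

namespace Summit.NavierStokesRegularity.NavierStokesRegularity.Theorems.PoloidalWindowDoorPoloidalWindowRigidityTimeShearLiminfDecay

open MeasureTheory Set Function Filter Topology Metric InnerProductSpace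
open scoped RealInnerProductSpace InnerProductSpace Laplacian ContDiff
open Literature.Analysis Literature.Analysis.FluidPDE
open Summit.NavierStokesRegularity.NavierStokesRegularity.Theorems.PoloidalWindowDoorPoloidalWindowRigidityWindow
open Summit.NavierStokesRegularity.NavierStokesRegularity.Theorems.PoloidalWindowDoorPoloidalWindowRigidityClassRate
open Summit.NavierStokesRegularity.NavierStokesRegularity.Theorems.PoloidalWindowDoorPoloidalWindowRigidityHorizontalMean
open Summit.NavierStokesRegularity.NavierStokesRegularity.Theorems.PoloidalWindowDoorPoloidalWindowRigidityConstantShearMeans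
open Summit.NavierStokesRegularity.NavierStokesRegularity.Theorems.PoloidalWindowDoorPoloidalWindowRigidityConstantShearSlice
open Summit.NavierStokesRegularity.NavierStokesRegularity.Theorems.PoloidalWindowDoorPoloidalWindowRigidityConstantShearVariance
open Summit.NavierStokesRegularity.NavierStokesRegularity.Theorems.PoloidalWindowDoorPoloidalWindowRigidityConstantShearGronwall
open Summit.NavierStokesRegularity.NavierStokesRegularity.Theorems.PoloidalWindowDoorPoloidalWindowRigidityConstantShearDecay
open Summit.NavierStokesRegularity.NavierStokesRegularity.Theorems.PoloidalWindowDoorPoloidalWindowRigidityTimeShearVariance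

variable {φ : ContDiffBump (0 : EuclideanSpace ℝ (Fin 2))} {R : ℝ}
  {v : ℝ → EuclideanSpace ℝ (Fin 3) → EuclideanSpace ℝ (Fin 3)} {C : ℝ}

section Class

variable (hrate : HasTypeITimeDecay C v) (hcont : ContinuousOn (uncurry v) (Iio (0 : ℝ) ×ˢ univ))
  (hmild : ∀ s t : ℝ, s < t → t < 0 → ∀ x,
    v t x = UnboundedOperators.heatExtension (v s) (t - s) x - oseenDuhamel 1 s v v t x)
  (hdiv : ∀ t < 0, VectorCalculus.IsDivFree (v t))
  (hpol : ∀ s < 0, ∀ y, ⟪curl (v s) y, EuclideanSpace.single 2 1⟫_ℝ = 0)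
  {μ : ℝ → ℝ} (hμneg : ∀ s < 0, μ s < 0) (hμd : ∀ s < 0, DifferentiableAt ℝ μ s)
  (hslope : ∀ s < 0, ∀ y, ∀ b : Fin 3, b ≠ 2 →
    fderiv ℝ (v s) y (EuclideanSpace.single 2 1) b = μ s * fderiv ℝ (v s) y (EuclideanSpace.single b 1) 2)

include hrate hcont hmild hdiv hpol hμneg hμd hslope

/-- **Grönwall for `(1 − μ)²Ψ` on `[t₀, t₁]`** (slope `μ < 1`, differentiable; `W` any bound for `1 − μ` on
`[t₀, t₁]`): `(1−μ(t₁))²Ψ(t₁) ≤ exp((6C/L)(√(−t₀) − √(−t₁)))·((1−μ(t₀))²Ψ(t₀) + W²·πL K(t₁)(t₁−t₀)/R)`.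
The integrating factor kills the source `2κΨ` of `…TimeShearVariance.deriv_psi_le_TV` exactly
(`((1−μ)²)′ = −2κ(1−μ)²`). -/
theorem psiW_le_TV_Icc {C₁ : ℝ} (hC₁ : ∀ t < 0, ∀ y, ‖fderiv ℝ (v t) y‖ ≤ C₁ / (-t))
    {C₄ : ℝ} (hC₄ : ∀ t < 0, ∀ y, ‖deriv (fun τ => v τ y) t‖ ≤ C₄ / ((-t) * Real.sqrt (-t)))
    (hR : 0 < R) {L : ℝ} (hL : 0 < L) {t₀ t₁ : ℝ} (h01 : t₀ ≤ t₁) (ht₁ : t₁ < 0)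
    {W : ℝ} (hW : ∀ s ∈ Icc t₀ t₁, 1 - μ s ≤ W) :
    (1 - μ t₁) ^ 2 * psi φ R v L t₁ ≤ Real.exp (6 * C / L * (Real.sqrt (-t₀) - Real.sqrt (-t₁))) *
      ((1 - μ t₀) ^ 2 * psi φ R v L t₀ +
        W ^ 2 * (R⁻¹ * (8 * (C / Real.sqrt (-t₁) * (C / Real.sqrt (-t₁)) * (C / Real.sqrt (-t₁))) +
          8 * (C / Real.sqrt (-t₁) * (C₁ / (-t₁)))) * bumpK φ * (Real.pi * L)) * (t₁ - t₀)) := by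
  have hA0 : IsTypeIAncientMild C v := isTypeIAncientMild_of_class hrate hcont hmild hdiv
  have hC0 : 0 ≤ C := hA0.nonneg
  have hC₁0 : 0 ≤ C₁ := by
    have h := (norm_nonneg _).trans (hC₁ t₁ ht₁ 0)
    rw [le_div_iff₀ (neg_pos.2 ht₁)] at h
    nlinarith [neg_pos.2 ht₁]
  have hK0 : 0 ≤ bumpK φ := bumpK_nonneg φ
  have hW0 : 0 ≤ W := le_trans (by linarith [hμneg t₁ ht₁]) (hW t₁ (right_mem_Icc.2 h01))
  -- the source term `b(t)` and its monotonicity on `t ≤ t₁`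
  set Kf : ℝ → ℝ := fun t => R⁻¹ * (8 * (C / Real.sqrt (-t) * (C / Real.sqrt (-t)) * (C / Real.sqrt (-t))) +
    8 * (C / Real.sqrt (-t) * (C₁ / (-t)))) * bumpK φ * (Real.pi * L) with hKf
  have hKmono : ∀ t ≤ t₁, Kf t ≤ Kf t₁ := by
    intro t ht
    have hnt : 0 < -t₁ := neg_pos.2 ht₁
    have h0 : C / Real.sqrt (-t) ≤ C / Real.sqrt (-t₁) :=
      div_le_div_of_nonneg_left hC0 (Real.sqrt_pos.2 hnt) (Real.sqrt_le_sqrt (by linarith))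
    have h1 : C₁ / (-t) ≤ C₁ / (-t₁) := div_le_div_of_nonneg_left hC₁0 hnt (by linarith)
    have hp0 : 0 ≤ C / Real.sqrt (-t) := div_nonneg hC0 (Real.sqrt_nonneg _)
    have hp1 : 0 ≤ C₁ / (-t) := div_nonneg hC₁0 (by linarith)
    simp only [hKf]
    gcongr
  have hKnonneg : ∀ t ≤ t₁, 0 ≤ Kf t := by
    intro t ht
    have hp0 : 0 ≤ C / Real.sqrt (-t) := div_nonneg hC0 (Real.sqrt_nonneg _)
    have hp1 : 0 ≤ C₁ / (-t) := div_nonneg hC₁0 (by linarith)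
    simp only [hKf]; positivity
  have hb0 : 0 ≤ Kf t₁ := hKnonneg t₁ le_rfl
  -- the comparison function `Φ(t) = e^{−A(t)} ((1−μ t)²Ψ(t) + W² b₀ (t₁ − t))`
  set A : ℝ → ℝ := fun τ => 6 * C / L * (Real.sqrt (-t₀) - Real.sqrt (-τ)) with hAdef
  set Φ : ℝ → ℝ := fun τ => Real.exp (-A τ) * ((1 - μ τ) ^ 2 * psi φ R v L τ + W ^ 2 * Kf t₁ * (t₁ - τ)) with hΦ
  have hderiv : ∀ τ, τ < 0 → t₀ ≤ τ → τ ≤ t₁ → ∃ d ≤ 0, HasDerivAt Φ d τ := by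
    intro τ hτ hτ₀ hτ₁
    have hA' := hasDerivAt_expo (C := C) L t₀ hτ
    have hpsi := hasDerivAt_psi (φ := φ) (R := R) hrate hcont hmild hdiv hC₄ hL.ne' hτ
    have hμ' : HasDerivAt μ (deriv μ τ) τ := (hμd τ hτ).hasDerivAt
    have hle := deriv_psi_le_TV (φ := φ) hrate hcont hmild hdiv hpol hslope hτ hμ' (by linarith [hμneg τ hτ]) hC₁ hR hL
    have hE : HasDerivAt (fun σ => Real.exp (-A σ)) (Real.exp (-A τ) * -(3 * (C / Real.sqrt (-τ)) / L)) τ :=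
      hA'.neg.exp
    -- the integrating factor
    have hm : HasDerivAt (fun σ => 1 - μ σ) (0 - deriv μ τ) τ := (hasDerivAt_const τ (1 : ℝ)).sub hμ'
    have hw : HasDerivAt (fun σ => (1 - μ σ) ^ 2) (2 * (1 - μ τ) * -deriv μ τ) τ := by
      have h := hm.mul hm
      have e : ((fun σ => 1 - μ σ) * fun σ => 1 - μ σ) = fun σ => (1 - μ σ) ^ 2 :=
        funext fun σ => by simp only [Pi.mul_apply]; ring
      rw [e] at h
      refine h.congr_deriv ?_
      ring
    have hlin : HasDerivAt (fun σ => (1 - μ σ) ^ 2 * psi φ R v L σ + W ^ 2 * Kf t₁ * (t₁ - σ))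
        (2 * (1 - μ τ) * -deriv μ τ * psi φ R v L τ + (1 - μ τ) ^ 2 * (∫ z, sliceVt φ R v τ z * wgt L z) +
          W ^ 2 * Kf t₁ * (0 - 1)) τ :=
      (hw.mul hpsi).add (((hasDerivAt_const τ t₁).sub (hasDerivAt_id τ)).const_mul (W ^ 2 * Kf t₁))
    refine ⟨_, ?_, hE.mul hlin⟩
    -- sign of the derivative
    have hpos : 0 < Real.exp (-A τ) := Real.exp_pos _
    have hA'0 : 0 ≤ 3 * (C / Real.sqrt (-τ)) / L :=
      div_nonneg (mul_nonneg (by norm_num) (div_nonneg hC0 (Real.sqrt_nonneg _))) hL.le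
    have hψ0 : 0 ≤ psi φ R v L τ := psi_nonneg hrate hcont hmild hdiv L hτ
    have hKτ := hKmono τ hτ₁
    have hKτ0 := hKnonneg τ hτ₁
    have hm1 : 0 < 1 - μ τ := by linarith [hμneg τ hτ]
    have hm1W : (1 - μ τ) ^ 2 ≤ W ^ 2 := pow_le_pow_left₀ hm1.le (hW τ ⟨hτ₀, hτ₁⟩) 2
    set m1 : ℝ := 1 - μ τ with hm1def
    set ψ : ℝ := psi φ R v L τ with hψdef
    set I : ℝ := ∫ z, sliceVt φ R v τ z * wgt L z with hIdef
    set a : ℝ := 3 * (C / Real.sqrt (-τ)) / L with hadef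
    -- `m1² Ψ' ≤ a m1² Ψ + 2 m1 μ' Ψ + m1² Kf τ`
    have hle' : I ≤ a * ψ + 2 * (deriv μ τ / m1) * ψ + Kf τ := by simpa only [hKf] using hle
    have hmul := mul_le_mul_of_nonneg_left hle' (sq_nonneg m1)
    have hinv : m1 * m1⁻¹ = 1 := mul_inv_cancel₀ hm1.ne'
    have e1 : m1 ^ 2 * (a * ψ + 2 * (deriv μ τ / m1) * ψ + Kf τ) =
        a * (m1 ^ 2 * ψ) + 2 * m1 * deriv μ τ * ψ + m1 ^ 2 * Kf τ := by
      rw [div_eq_mul_inv]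
      linear_combination (2 * m1 * deriv μ τ * ψ) * hinv
    rw [e1] at hmul
    have hf1 : m1 ^ 2 * Kf τ ≤ W ^ 2 * Kf t₁ := mul_le_mul hm1W hKτ hKτ0 (sq_nonneg W)
    have hf2 : 0 ≤ a * (W ^ 2 * Kf t₁ * (t₁ - τ)) := mul_nonneg hA'0 (mul_nonneg (mul_nonneg (sq_nonneg W) hb0) (by linarith))
    have hrest : Real.exp (-A τ) * -a * (m1 ^ 2 * ψ + W ^ 2 * Kf t₁ * (t₁ - τ)) +
        Real.exp (-A τ) * (2 * m1 * -deriv μ τ * ψ + m1 ^ 2 * I + W ^ 2 * Kf t₁ * (0 - 1)) =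
      Real.exp (-A τ) * ((m1 ^ 2 * I - a * (m1 ^ 2 * ψ) - 2 * m1 * deriv μ τ * ψ - m1 ^ 2 * Kf τ) +
        (m1 ^ 2 * Kf τ - W ^ 2 * Kf t₁) - a * (W ^ 2 * Kf t₁ * (t₁ - τ))) := by ring
    rw [hrest]
    refine mul_nonpos_of_nonneg_of_nonpos hpos.le ?_
    linarith
  -- `Φ` is antitone on `[t₀, t₁]`
  have hanti : AntitoneOn Φ (Icc t₀ t₁) := by
    refine antitoneOn_of_deriv_nonpos (convex_Icc t₀ t₁) ?_ ?_ ?_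
    · intro τ hτ
      obtain ⟨d, -, hd⟩ := hderiv τ (lt_of_le_of_lt hτ.2 ht₁) hτ.1 hτ.2
      exact hd.continuousAt.continuousWithinAt
    · intro τ hτ
      rw [interior_Icc] at hτ
      obtain ⟨d, -, hd⟩ := hderiv τ (hτ.2.trans ht₁) hτ.1.le hτ.2.le
      exact hd.differentiableAt.differentiableWithinAt
    · intro τ hτ
      rw [interior_Icc] at hτ
      obtain ⟨d, hd0, hd⟩ := hderiv τ (hτ.2.trans ht₁) hτ.1.le hτ.2.le
      rw [hd.deriv]; exact hd0
  have hcmp := hanti (left_mem_Icc.2 h01) (right_mem_Icc.2 h01) h01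
  -- unfold the comparison `Φ t₁ ≤ Φ t₀`
  have hA₀ : A t₀ = 0 := by simp [hAdef]
  simp only [hΦ, hA₀, neg_zero, Real.exp_zero, one_mul, sub_self, mul_zero, add_zero] at hcmp
  have hpos : 0 < Real.exp (A t₁) := Real.exp_pos _
  have hmul := mul_le_mul_of_nonneg_left hcmp hpos.le
  rw [← mul_assoc, ← Real.exp_add, add_neg_cancel, Real.exp_zero, one_mul] at hmul
  have e2 : W ^ 2 * Kf t₁ * (t₁ - t₀) = W ^ 2 * Kf t₁ * (t₁ - t₀) := rfl
  simpa only [hAdef, hKf, mul_assoc] using hmul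

/-- **THE HORIZONTAL VARIANCE OF `v₂` HAS NO PAST ON (TV), BRANCH (B).**  For a profile of the class (rate `C`,
gradient rate `C₁`, time-derivative rate `C₄`), poloidal, with all-slices proportional shear of slope `μ(·) < 1`
(differentiable) and `μ ≥ −M` ALONG SOME SEQUENCE OF TIMES `τ → −∞` (`∀ T, ∃ τ < T, −M ≤ μ τ`): for every `t₁ < 0`,
every height window `[a, b]` and every `ε > 0` there is `R₀ > 0` such that the horizontal variance of `v₂` at scale
`R ≥ R₀` satisfies `∫_{[a,b]} V_R(t₁, z) dz ≤ ε`. -/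
theorem variance_small_liminf {C₁ : ℝ} (hC₁ : ∀ t < 0, ∀ y, ‖fderiv ℝ (v t) y‖ ≤ C₁ / (-t))
    {C₄ : ℝ} (hC₄ : ∀ t < 0, ∀ y, ‖deriv (fun τ => v τ y) t‖ ≤ C₄ / ((-t) * Real.sqrt (-t)))
    {M : ℝ} (hM : ∀ T : ℝ, ∃ τ < T, -M ≤ μ τ)
    {t₁ : ℝ} (ht₁ : t₁ < 0) (a b : ℝ) {ε : ℝ} (hε : 0 < ε) :
    ∃ R₀ : ℝ, 0 < R₀ ∧ ∀ R' : ℝ, R₀ ≤ R' → ∫ z in Icc a b, sliceV φ R' v t₁ z ≤ ε := by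
  have hA0 : IsTypeIAncientMild C v := isTypeIAncientMild_of_class hrate hcont hmild hdiv
  have hC0 : 0 ≤ C := hA0.nonneg
  have hnt₁ : 0 < -t₁ := neg_pos.2 ht₁
  have hC₁0 : 0 ≤ C₁ := by
    have h := (norm_nonneg _).trans (hC₁ t₁ ht₁ 0)
    rw [le_div_iff₀ hnt₁] at h
    nlinarith
  have hK0 : 0 ≤ bumpK φ := bumpK_nonneg φ
  -- the weight at `t₁` and the rescaled target
  set w₁ : ℝ := (1 - μ t₁) ^ 2 with hw₁
  have hm₁ : 0 < 1 - μ t₁ := by linarith [hμneg t₁ ht₁]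
  have hw₁0 : 0 < w₁ := pow_pos hm₁ 2
  set ε' : ℝ := ε * w₁ with hε'
  have hε'0 : 0 < ε' := mul_pos hε hw₁0
  -- constants
  set A₀ : ℝ := Real.exp (6 * C) with hA₀
  have hA₀0 : 0 < A₀ := Real.exp_pos _
  set M₀ : ℝ := C / Real.sqrt (-t₁) with hM₀
  set Kc : ℝ := 8 * (M₀ * M₀ * M₀) + 8 * (M₀ * (C₁ / (-t₁))) with hKc
  have hM₀0 : 0 ≤ M₀ := div_nonneg hC0 (Real.sqrt_nonneg _)
  have hKc0 : 0 ≤ Kc := by have : 0 ≤ C₁ / (-t₁) := div_nonneg hC₁0 hnt₁.le; positivity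
  set B : ℝ := (1 + M) ^ 2 with hB
  have hB0 : 0 ≤ B := sq_nonneg _
  -- the lower bound for the scale `L`, and a time `t₀` of the sequence below `−Lm² − 1`
  set Lm : ℝ := max (max |a| |b|) (max 1 (max (Real.sqrt (-t₁)) (4 * A₀ * Real.pi * C ^ 2 * B / ε'))) with hLm
  have hLm1 : 1 ≤ Lm := le_trans (le_max_left _ _) (le_max_right _ _)
  have hLm0 : 0 < Lm := lt_of_lt_of_le one_pos hLm1
  obtain ⟨t₀, ht₀T, hμt₀⟩ := hM (-(Lm ^ 2) - 1)
  have hnt₀ : Lm ^ 2 < -t₀ := by linarith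
  have ht₀ : t₀ < 0 := by nlinarith
  set L : ℝ := Real.sqrt (-t₀) with hL
  have hLmL : Lm ≤ L := by
    rw [hL, ← Real.sqrt_sq hLm0.le]
    exact Real.sqrt_le_sqrt hnt₀.le
  have hL1 : 1 ≤ L := hLm1.trans hLmL
  have hL0 : 0 < L := lt_of_lt_of_le one_pos hL1
  have hLa : |a| ≤ L := le_trans (le_trans (le_max_left _ _) (le_max_left _ _)) hLmL
  have hLb : |b| ≤ L := le_trans (le_trans (le_max_right _ _) (le_max_left _ _)) hLmL
  have hLs : Real.sqrt (-t₁) ≤ L :=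
    le_trans (le_trans (le_trans (le_max_left _ _) (le_max_right _ _)) (le_max_right _ _)) hLmL
  have hLε : 4 * A₀ * Real.pi * C ^ 2 * B / ε' ≤ L :=
    le_trans (le_trans (le_trans (le_max_right _ _) (le_max_right _ _)) (le_max_right _ _)) hLmL
  have hnt₀' : -t₀ = L ^ 2 := by rw [hL, Real.sq_sqrt (neg_pos.2 ht₀).le]
  have h01 : t₀ ≤ t₁ := by
    have h := Real.sq_sqrt hnt₁.le
    have h2 : Real.sqrt (-t₁) ^ 2 ≤ L ^ 2 := pow_le_pow_left₀ (Real.sqrt_nonneg _) hLs 2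
    linarith
  -- the weight along `[t₀, t₁]`: a compact maximum `W`, and the datum weight `(1 − μ t₀)² ≤ B`
  have hμc : ContinuousOn (fun s => 1 - μ s) (Icc t₀ t₁) := fun s hs =>
    (continuousAt_const.sub (hμd s (lt_of_le_of_lt hs.2 ht₁)).continuousAt).continuousWithinAt
  obtain ⟨s₀, hs₀, hmax⟩ := isCompact_Icc.exists_isMaxOn (nonempty_Icc.2 h01) hμc
  set W : ℝ := 1 - μ s₀ with hWdef
  have hW : ∀ s ∈ Icc t₀ t₁, 1 - μ s ≤ W := fun s hs => isMaxOn_iff.1 hmax s hs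
  have hwt₀ : (1 - μ t₀) ^ 2 ≤ B := by
    have h1 : 0 ≤ 1 - μ t₀ := by linarith [hμneg t₀ ht₀]
    have h2 : 1 - μ t₀ ≤ 1 + M := by linarith
    rw [hB]
    exact pow_le_pow_left₀ h1 h2 2
  -- the threshold in `R`
  set D : ℝ := A₀ * (W ^ 2 * (Kc * bumpK φ * (Real.pi * L)) * L ^ 2) with hD
  have hD0 : 0 ≤ D := by positivity
  refine ⟨max 1 (4 * D / ε'), lt_of_lt_of_le one_pos (le_max_left _ _), fun R' hR' => ?_⟩
  have hR'0 : 0 < R' := lt_of_lt_of_le one_pos ((le_max_left _ _).trans hR')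
  have hR'D : 4 * D / ε' ≤ R' := (le_max_right _ _).trans hR'
  -- Grönwall from `t₀` to `t₁`
  have hG := psiW_le_TV_Icc (φ := φ) (R := R') hrate hcont hmild hdiv hpol hμneg hμd hslope hC₁ hC₄ hR'0 hL0 h01 ht₁ hW
  rw [← hL] at hG
  have hexp : Real.exp (6 * C / L * (L - Real.sqrt (-t₁))) ≤ A₀ := by
    rw [hA₀]
    refine Real.exp_le_exp.2 ?_
    have h1 : 6 * C / L * (L - Real.sqrt (-t₁)) = 6 * C - 6 * C * Real.sqrt (-t₁) / L := by field_simp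
    rw [h1]
    have : 0 ≤ 6 * C * Real.sqrt (-t₁) / L := by positivity
    linarith
  have hψ₀ : psi φ R' v L t₀ ≤ Real.pi * C ^ 2 / L := by
    have h := psi_le_rate (φ := φ) (R := R') hrate hcont hmild hdiv hL0 ht₀
    rw [hnt₀'] at h
    have e : C ^ 2 / L ^ 2 * (Real.pi * L) = Real.pi * C ^ 2 / L := by field_simp
    linarith [e.symm.le, e.le]
  have hψ₀w : (1 - μ t₀) ^ 2 * psi φ R' v L t₀ ≤ B * (Real.pi * C ^ 2 / L) :=
    mul_le_mul hwt₀ hψ₀ (psi_nonneg hrate hcont hmild hdiv L ht₀) hB0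
  have hdt : t₁ - t₀ ≤ L ^ 2 := by linarith
  have hb0 : 0 ≤ W ^ 2 * (R'⁻¹ * Kc * bumpK φ * (Real.pi * L)) := by positivity
  have hψ₁ : w₁ * psi φ R' v L t₁ ≤ A₀ * (B * (Real.pi * C ^ 2 / L)) + D / R' := by
    have h2 : R'⁻¹ * (8 * (C / Real.sqrt (-t₁) * (C / Real.sqrt (-t₁)) * (C / Real.sqrt (-t₁))) +
        8 * (C / Real.sqrt (-t₁) * (C₁ / (-t₁)))) * bumpK φ * (Real.pi * L) =
        R'⁻¹ * Kc * bumpK φ * (Real.pi * L) := by rw [hKc, hM₀]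
    rw [h2] at hG
    have h1 : (1 - μ t₀) ^ 2 * psi φ R' v L t₀ + W ^ 2 * (R'⁻¹ * Kc * bumpK φ * (Real.pi * L)) * (t₁ - t₀) ≤
        B * (Real.pi * C ^ 2 / L) + W ^ 2 * (R'⁻¹ * Kc * bumpK φ * (Real.pi * L)) * L ^ 2 :=
      add_le_add hψ₀w (mul_le_mul_of_nonneg_left hdt hb0)
    have h0 : 0 ≤ (1 - μ t₀) ^ 2 * psi φ R' v L t₀ + W ^ 2 * (R'⁻¹ * Kc * bumpK φ * (Real.pi * L)) * (t₁ - t₀) :=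
      add_nonneg (mul_nonneg (sq_nonneg _) (psi_nonneg hrate hcont hmild hdiv L ht₀)) (mul_nonneg hb0 (by linarith))
    calc w₁ * psi φ R' v L t₁
        ≤ A₀ * ((1 - μ t₀) ^ 2 * psi φ R' v L t₀ + W ^ 2 * (R'⁻¹ * Kc * bumpK φ * (Real.pi * L)) * (t₁ - t₀)) :=
          hG.trans (mul_le_mul_of_nonneg_right hexp h0)
      _ ≤ A₀ * (B * (Real.pi * C ^ 2 / L) + W ^ 2 * (R'⁻¹ * Kc * bumpK φ * (Real.pi * L)) * L ^ 2) :=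
          mul_le_mul_of_nonneg_left h1 hA₀0.le
      _ = A₀ * (B * (Real.pi * C ^ 2 / L)) + D / R' := by rw [hD]; field_simp
  -- both terms are `≤ ε'/4`
  have hq1 : A₀ * (B * (Real.pi * C ^ 2 / L)) ≤ ε' / 4 := by
    have e0 : A₀ * (B * (Real.pi * C ^ 2 / L)) = (A₀ * B * Real.pi * C ^ 2) / L := by ring
    rw [e0, div_le_iff₀ hL0]
    have h := mul_le_mul_of_nonneg_left hLε (by positivity : (0:ℝ) ≤ ε' / 4)
    have e : ε' / 4 * (4 * A₀ * Real.pi * C ^ 2 * B / ε') = A₀ * B * Real.pi * C ^ 2 := by field_simp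
    linarith [e]
  have hq2 : D / R' ≤ ε' / 4 := by
    rw [div_le_iff₀ hR'0]
    have h := mul_le_mul_of_nonneg_left hR'D (by positivity : (0:ℝ) ≤ ε' / 4)
    have e : ε' / 4 * (4 * D / ε') = D := by field_simp
    linarith [e]
  have hψε' : w₁ * psi φ R' v L t₁ ≤ ε' / 2 := by linarith
  have hψε : psi φ R' v L t₁ ≤ ε / 2 := by
    have e : ε' / 2 = w₁ * (ε / 2) := by rw [hε']; ring
    rw [e] at hψε'
    exact le_of_mul_le_mul_left hψε' hw₁0
  -- from the weighted integral to the window `[a, b]`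
  obtain ⟨cV, -, -, -⟩ := continuous_slices (φ := φ) (R := R') hrate hcont hmild hdiv ht₁
  have hV0 := fun z => sliceV_nonneg (φ := φ) (R := R') hrate hcont hmild hdiv ht₁ z
  have iVw1 : Integrable fun z => sliceV φ R' v t₁ z * wgt L z := by
    refine integrable_of_abs_le_mul_wgt hL0.ne' (f := fun z => sliceV φ R' v t₁ z * wgt L z)
      (cV.mul (continuous_wgt L)) (B := C ^ 2 / (-t₁)) fun z => ?_
    rw [abs_mul, abs_of_pos (wgt_pos L z), abs_of_nonneg (hV0 z)]
    exact mul_le_mul_of_nonneg_right (sliceV_le hrate hcont hmild hdiv ht₁ z) (wgt_pos L z).le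
  have iVw : Integrable fun z => 2 * (sliceV φ R' v t₁ z * wgt L z) := iVw1.const_mul 2
  have hwin : ∀ z ∈ Icc a b, sliceV φ R' v t₁ z ≤ 2 * (sliceV φ R' v t₁ z * wgt L z) := by
    intro z hz
    have ha' := abs_le.1 hLa
    have hb' := abs_le.1 hLb
    have hzL : |z| ≤ L := abs_le.2 ⟨by linarith [ha'.1, hz.1], by linarith [hb'.2, hz.2]⟩
    have hw := half_le_wgt hL0 hzL
    have h1 : sliceV φ R' v t₁ z * (1 / 2) ≤ sliceV φ R' v t₁ z * wgt L z := mul_le_mul_of_nonneg_left hw (hV0 z)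
    linarith
  calc ∫ z in Icc a b, sliceV φ R' v t₁ z ≤ ∫ z in Icc a b, 2 * (sliceV φ R' v t₁ z * wgt L z) :=
        setIntegral_mono_on cV.integrableOn_Icc iVw.integrableOn measurableSet_Icc hwin
    _ ≤ ∫ z, 2 * (sliceV φ R' v t₁ z * wgt L z) :=
        setIntegral_le_integral iVw (Eventually.of_forall fun z =>
          mul_nonneg zero_le_two (mul_nonneg (hV0 z) (wgt_pos L z).le))
    _ = 2 * psi φ R' v L t₁ := by unfold psi; exact integral_const_mul _ _
    _ ≤ ε := by linarith


end Class

end Summit.NavierStokesRegularity.NavierStokesRegularity.Theorems.PoloidalWindowDoorPoloidalWindowRigidityTimeShearLiminfDecay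

end
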